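import Summits.CriticalPhenomena.CardyFormulaZ2.Theses.CardyDualCurrent
import Summits.CriticalPhenomena.CardyFormulaZ2.Theorems.CardyDualCurrentTemplateCanonicalLimitNormalisation
import Summits.CriticalPhenomena.CardyFormulaZ2.Theorems.CardyDualCurrentCanonicalLimitFromExactCRStubLimitHolomorphic
import Summits.CriticalPhenomena.CardyFormulaZ2.Theorems.CardyDualCurrentCanonicalLimitFromExactCRStubLimitAntiHolomorphic
import Summits.CriticalPhenomena.CardyFormulaZ2.Theorems.CardyDualCurrentCanonicalLimitFromExactCRStubPrecompactOfBounded
import Literature.Probability.LatticeModels.LocalParafermionicTemplate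

/-!
# Line `registered` — crux `CardyDualCurrent.CanonicalLimitFromExactCR` (item stmt-CriticalPhenomena-11394)

Route `route-CriticalPhenomena-CardyDualCurrent`, sub-problem `CardyFormulaZ2`, crux (rank 4)
`Summit.CriticalPhenomena.CardyFormulaZ2.Theses.CardyDualCurrent.CanonicalLimitFromExactCR`:
an exactly discrete-holomorphic (Duffin Cauchy–Riemann at every deep primal vertex and face),
deep-window non-degenerate finite-range local parafermionic template (the body of
`DualCurrentTemplateR`) forces the CANONICAL spin-`1/3` scaling limit along every admissible
square-lattice discretisation family: some template and a lattice constant `C > 0` satisfy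
`θ_δ · C · δ^{-1/3} · G_{E δ}(⌊w/δ⌋, i) → q`, `q³ = ψ'/ψ`, locally uniformly on `D`, for every
Dobrushin domain `D`, every `ZdDiscretisationFamily E`, every chordal uniformizer `φ = ψ⁻¹` and
every holomorphic branch `q` (the body of `TemplateCanonicalLimit`; Smirnov 2010 Thm 2.2 /
Conj. 2.4 at `σ = 1/3`).

## Lead's reshaped skeleton (cycle 1, 2026-08-17): Morera + anti-Morera + Precompactness + SHAPE-core + SIZE-core

The birth skeleton cut the crux into SHAPE (`stub_projectiveShape`: projective convergence
`c_δ · G → q` for EVERY `φ`, EVERY branch `q`) and SIZE (`stub_canonicalAmplitude`: for every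
exactly-CR non-degenerate template ONE lattice constant with `‖c_δ‖ δ^{1/3} → C` for EVERY
normaliser family `c` realising the projective convergence, any `φ`, `q`).  Both universal
quantifications over `(φ, q, c)` are FREE — pure analysis, proved in this file — so the
registered stubs are now their cores:

* `stub_shapeCore` — from a witness of `DualCurrentTemplateR`, SOME exactly-CR non-degenerate
  `T : LocalParafermionicTemplate` whose observable `T.obs` converges projectively, for every
  `(D, E)`, to ONE holomorphic cube root `q` of `ψ'/ψ` for ONE chordal `φ`, after SOME complex
  normalisers `c_δ`.  (`projectiveShape_of_core`: `ψ'/ψ` does not depend on the chordal map,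
  `deriv_symm_div_symm_eq_of_isChordalUniformizing`; two branches differ by a constant unit,
  `cubeRootBranch_exists_const`; the unit is absorbed into `c_δ`.)
* `stub_sizeCore` — for every exactly-CR non-degenerate `T` there is ONE `C > 0` such that for
  every `(D, E)`, IF some `(φ, q, c)` realises the projective convergence THEN some `(φ, q, c)`
  realises it with the sharp amplitude `‖c_δ‖ · δ^{1/3} → C`.  (`canonicalAmplitude_of_core`:
  any two normaliser families of the same observable have `‖c'_δ‖/‖c_δ‖ → 1`, because `q` is
  zero-free and `q' = ω q`, `‖ω‖ = 1`: `amplitude_of_other_normalisation`, found by the stub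
  worker of `stub_canonicalAmplitude`.)

Reshape 2 (same cycle) threads the one piece of the Smirnov-type architecture that is provable
today as its own registered stub, `stub_limitHolomorphic` (PROVED, 600 lines, file
`Theorems/CardyDualCurrentCanonicalLimitFromExactCRStubLimitHolomorphic.lean`): subsequential
limits `(g₀, g₁)` of a renormalised exactly-CR template observable along a discretisation family
have `g₀ + g₁` holomorphic (discrete Cauchy theorem `boundary_sum_eq_zero_of_cr` + Riemann sums
+ Morera); the SHAPE core receives it as a hypothesis (`stub_shapeFromMorera`).
Reshape 3 (same cycle) adds the second provable leg, `stub_precompactOfBounded` (PROVED, file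
`Theorems/CardyDualCurrentCanonicalLimitFromExactCRStubPrecompactOfBounded.lean`, over the new
Literature file `LatticeHarmonicCompactnessLocal.lean`): exact CR ⇒ edge functions discrete
harmonic (Duffin) ⇒ locally bounded renormalisations have locally uniformly convergent
subsequences.  `CanonicalLimitFromExactCR_of : Stubs.stub_limitHolomorphic →
Stubs.stub_precompactOfBounded → Stubs.stub_shapeBoundsAndIdentification → Stubs.stub_sizeCore →
crux` composes them through the birth skeleton's `phase_normalisation` (`θ_δ = c_δ/‖c_δ‖`, real
correction `ρ_δ = C δ^{-1/3}/‖c_δ‖ → 1`).  Reshape 4 adds `stub_limitAntiHolomorphic` (PROVED: exact CR is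
invariant under conjugate-staggering, so `g₀ - g₁` is anti-holomorphic).  Integration (end of
cycle 1): the three proved legs are LANDED (p150633, p151270, p151245) and imported; `lean
check`: sorries = 2 = the remaining registered stubs `stub_shapeBoundsAndIdentification`,
`stub_sizeCore`, both blocked on the decision crux stmt-CriticalPhenomena-11201.

## Status of the cores (honest)

Both cores keep the crux's antecedent — verbatim the body of the OPEN decision crux
`DualCurrentTemplateR` (stmt-CriticalPhenomena-11201, planner prior: FALSE;
`LocalParafermionicTemplate.exists_isExactCR_and_nondegenerate_iff`).  Hence: (i) both are TRUE
FOR FREE if stmt-11201 is refuted (`shapeCore_of_not_dualCurrentTemplateR`,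
`sizeCore_of_not_dualCurrentTemplateR` below), and any counterexample to either is a witness of
stmt-11201 — neither is refutable before r2 is decided positively; (ii) given a witness, what
remains is Smirnov 2010 Conj. 2.4 / Duminil-Copin–Smirnov 2012 Conj. 8.7 at `q = 1` for a
template observable — shape (precompactness at scale `δ^{-1/3}`, holomorphy of subsequential
limits by the discrete Cauchy theorem `boundary_sum_eq_zero_of_cr` + Morera, Riemann–Hilbert
boundary values `Im(f τ^{1/3}) = 0` and their uniqueness) and size (sharp one-point amplitude).
A structural caveat found this cycle (lead NOTES, `## Census`): exact CR in all admissible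
domains does NOT determine the boundary values — the class of exactly-CR templates is stable
under lattice shift-differences (a CR template `S` with canonical limit `∝ δ^{1/3} q` yields the CR
template `S - S(· + e₀)` of range `r + 2` with limit `∝ δ^{4/3} q'`, a different Riemann–Hilbert
datum) and contains sublattice-staggered members (`+1` on horizontal, `-1` on vertical edges is
exactly CR), whose two edge-type limits `g₀ ≠ g₁` have `g₀ + g₁` holomorphic and `g₀ - g₁`
ANTI-holomorphic; so the canonical boundary behaviour must come from the specific template the
core re-chooses (Smirnov's boundary argument), not from the CR clause.

Disproof used: none filed for this crux (`Cruxes/CanonicalLimitFromExactCR/` holds only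
`Lines/birth.*`, `PICKED.md`; no `Disproof.lean`, no `Negative/` lemma; 2026-08-17).
-/

namespace Summit.CriticalPhenomena.CardyFormulaZ2.Cruxes.CanonicalLimitFromExactCR.Birth

open scoped BigOperators Topology Manifold Classical MeasureTheory ProbabilityTheory Matrix InnerProductSpace ComplexConjugate ContinuousMap
open Filter Set Function TopologicalSpace MeasureTheory
open Summit.CriticalPhenomena.CardyFormulaZ2.Theses.CardyDualCurrent (CanonicalLimitFromExactCR DualCurrentTemplateR)
open Literature.Probability.LatticeModels Literature.Probability.RandomPlanarGeometry
open Literature.Probability.Percolation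
open Summit.CriticalPhenomena.CardyFormulaZ2.Theorems (cubeRootBranch_exists_const)

/-! ### Analytic glue for the assembly (sorry-free) -/

section Glue

variable {ι α β : Type*} [TopologicalSpace α]

/-- Locally uniform convergence on a set is insensitive to an EVENTUAL (in the index filter)
modification of the approximants on the set. [folklore] -/
theorem tendstoLocallyUniformlyOn_of_eventuallyEq [UniformSpace β] {F F' : ι → α → β}
    {f : α → β} {p : Filter ι} {s : Set α} (h : TendstoLocallyUniformlyOn F f p s)
    (h' : ∀ᶠ n in p, ∀ y ∈ s, F n y = F' n y) : TendstoLocallyUniformlyOn F' f p s := by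
  intro u hu x hx
  obtain ⟨t, ht, hev⟩ := h u hu x hx
  refine ⟨t ∩ s, inter_mem ht self_mem_nhdsWithin, ?_⟩
  filter_upwards [hev, h'] with n hn hn' y hy
  rw [← hn' y hy.2]
  exact hn y hy.1

/-- Real scalars tending to one preserve locally uniform convergence to a CONTINUOUS limit:
if `G_n → q` locally uniformly on `s`, `q` is continuous on `s` and `ρ_n → 1`, then
`ρ_n G_n → q` locally uniformly on `s` (an `ε/4`-argument; `q` is locally bounded on `s`).
[folklore] -/
theorem tendstoLocallyUniformlyOn_ofReal_mul {G : ι → α → ℂ} {q : α → ℂ} {p : Filter ι}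
    {s : Set α} {ρ : ι → ℝ} (hG : TendstoLocallyUniformlyOn G q p s) (hq : ContinuousOn q s)
    (hρ : Tendsto ρ p (𝓝 1)) :
    TendstoLocallyUniformlyOn (fun n w => (ρ n : ℂ) * G n w) q p s := by
  rw [Metric.tendstoLocallyUniformlyOn_iff] at hG ⊢
  intro ε hε x hx
  have hε' : 0 < ε := hε
  have hM : 0 < ‖q x‖ + 1 := by positivity
  obtain ⟨t, ht, hev⟩ := hG (ε / 4) (by positivity) x hx
  have hqx : ∀ᶠ y in 𝓝[s] x, dist (q y) (q x) < 1 :=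
    Metric.tendsto_nhds.mp (hq x hx).tendsto 1 one_pos
  refine ⟨t ∩ {y | dist (q y) (q x) < 1}, inter_mem ht hqx, ?_⟩
  have hρev : ∀ᶠ n in p, dist (ρ n) 1 < min (1 / 2) (ε / (4 * (‖q x‖ + 1))) :=
    Metric.tendsto_nhds.mp hρ _ (lt_min one_half_pos (by positivity))
  filter_upwards [hev, hρev] with n hn hρn y hy
  obtain ⟨hyt, hyq⟩ := hy
  have h1 : dist (q y) (G n y) < ε / 4 := hn y hyt
  have hyq' : dist (q y) (q x) < 1 := hyq
  have hqy : ‖q y‖ < ‖q x‖ + 1 := by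
    have e : q x + (q y - q x) = q y := by ring
    calc ‖q y‖ = ‖q x + (q y - q x)‖ := by rw [e]
      _ ≤ ‖q x‖ + ‖q y - q x‖ := norm_add_le _ _
      _ < ‖q x‖ + 1 := by rw [← dist_eq_norm]; linarith
  rw [Real.dist_eq] at hρn
  have hρ1 : |ρ n - 1| < 1 / 2 := lt_of_lt_of_le hρn (min_le_left _ _)
  have hρ2 : |ρ n - 1| < ε / (4 * (‖q x‖ + 1)) := lt_of_lt_of_le hρn (min_le_right _ _)
  have hρabs : |ρ n| < 3 / 2 := by
    have := abs_sub_abs_le_abs_sub (ρ n) 1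
    rw [abs_one] at this
    linarith
  have hA : |ρ n| * dist (q y) (G n y) ≤ 3 / 2 * (ε / 4) :=
    mul_le_mul hρabs.le h1.le dist_nonneg (by norm_num)
  have hB : |1 - ρ n| * ‖q y‖ ≤ ε / (4 * (‖q x‖ + 1)) * (‖q x‖ + 1) := by
    rw [abs_sub_comm]
    exact mul_le_mul hρ2.le hqy.le (norm_nonneg _) (by positivity)
  have hE : ε / (4 * (‖q x‖ + 1)) * (‖q x‖ + 1) = ε / 4 := by
    rw [div_mul_eq_mul_div, mul_div_mul_right _ _ hM.ne']
  have key : q y - (ρ n : ℂ) * G n y = (ρ n : ℂ) * (q y - G n y) + ((1 - ρ n : ℝ) : ℂ) * q y := by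
    push_cast
    ring
  show dist (q y) ((ρ n : ℂ) * G n y) < ε
  calc dist (q y) ((ρ n : ℂ) * G n y)
      = ‖(ρ n : ℂ) * (q y - G n y) + ((1 - ρ n : ℝ) : ℂ) * q y‖ := by rw [dist_eq_norm, key]
    _ ≤ ‖(ρ n : ℂ) * (q y - G n y)‖ + ‖((1 - ρ n : ℝ) : ℂ) * q y‖ := norm_add_le _ _
    _ = |ρ n| * dist (q y) (G n y) + |1 - ρ n| * ‖q y‖ := by
        rw [norm_mul, norm_mul, Complex.norm_real, Complex.norm_real, Real.norm_eq_abs,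
          Real.norm_eq_abs, dist_eq_norm]
    _ ≤ 3 / 2 * (ε / 4) + ε / (4 * (‖q x‖ + 1)) * (‖q x‖ + 1) := add_le_add hA hB
    _ < ε := by rw [hE]; linarith

/-- **Phase normalisation.** If complex normalisers `c_δ` make `c_δ · F_i(δ, ·) → q` locally
uniformly on `s` (both `i`), `q` is continuous on `s`, and the normalisers have the sharp size
`‖c_δ‖ · δ^{1/3} → C > 0`, then the unit phases `θ_δ = c_δ / ‖c_δ‖` give
`θ_δ · C · δ^{-1/3} · F_i(δ, ·) → q` locally uniformly on `s` — the exact shape of the crux's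
conclusion. [folklore] -/
theorem phase_normalisation {s : Set α} {F : Fin 2 → ℝ → α → ℂ} {q : α → ℂ} {c : ℝ → ℂ}
    {C : ℝ} (hC : 0 < C) (hq : ContinuousOn q s)
    (hc : ∀ i : Fin 2, TendstoLocallyUniformlyOn (fun (δ : ℝ) (w : α) => c δ * F i δ w) q
      (𝓝[>] (0 : ℝ)) s)
    (hT : Tendsto (fun δ : ℝ => ‖c δ‖ * δ ^ (1 / 3 : ℝ)) (𝓝[>] (0 : ℝ)) (𝓝 C)) :
    ∃ θ : ℝ → ℂ, (∀ δ, ‖θ δ‖ = 1) ∧ ∀ i : Fin 2, TendstoLocallyUniformlyOn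
      (fun (δ : ℝ) (w : α) => θ δ * C * ((δ ^ (-(1 / 3 : ℝ)) : ℝ) : ℂ) * F i δ w) q
      (𝓝[>] (0 : ℝ)) s := by
  classical
  refine ⟨fun δ => if c δ = 0 then 1 else ((‖c δ‖⁻¹ : ℝ) : ℂ) * c δ, fun δ => ?_, fun i => ?_⟩
  · show ‖(if c δ = 0 then (1 : ℂ) else ((‖c δ‖⁻¹ : ℝ) : ℂ) * c δ)‖ = 1
    split_ifs with h
    · exact norm_one
    · rw [norm_mul, Complex.norm_real, norm_inv, norm_norm,
        inv_mul_cancel₀ (norm_ne_zero_iff.mpr h)]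
  · -- the normalisers are eventually non-zero
    have hne : ∀ᶠ δ in 𝓝[>] (0 : ℝ), c δ ≠ 0 := by
      filter_upwards [hT.eventually_const_lt (half_lt_self hC)] with δ hδ h0
      rw [h0, norm_zero, zero_mul] at hδ
      linarith
    -- the real correction factor tends to one
    have hρ : Tendsto (fun δ : ℝ => ‖c δ‖⁻¹ * C * δ ^ (-(1 / 3 : ℝ))) (𝓝[>] (0 : ℝ)) (𝓝 1) := by
      have h2 : Tendsto (fun δ : ℝ => C * (‖c δ‖ * δ ^ (1 / 3 : ℝ))⁻¹) (𝓝[>] (0 : ℝ))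
          (𝓝 (C * C⁻¹)) := (hT.inv₀ hC.ne').const_mul C
      rw [mul_inv_cancel₀ hC.ne'] at h2
      refine h2.congr' ?_
      filter_upwards [self_mem_nhdsWithin] with δ hδ
      rw [Set.mem_Ioi] at hδ
      rw [Real.rpow_neg hδ.le, mul_inv]
      ring
    refine tendstoLocallyUniformlyOn_of_eventuallyEq
      (tendstoLocallyUniformlyOn_ofReal_mul (hc i) hq hρ) ?_
    filter_upwards [hne, self_mem_nhdsWithin] with δ hδ hpos y hy
    try dsimp only
    rw [if_neg hδ]
    push_cast
    ring

end Glue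

/-! ### Normalisation glue: uniformizer, branch and normaliser are free (sorry-free) -/

section Normalisation

/-- **Projective convergence for one normalisation gives it for all.** Let `F i : ℝ → ℂ → ℂ`
(`i : Fin 2`) be any mesh-indexed functions on a Dobrushin domain `D`. If for SOME chordal
uniformizer `φ`, SOME holomorphic `q` with `q³ = ψ'/ψ` (`ψ = φ⁻¹`) and SOME normalisers `c_δ`
one has `c_δ · F i δ → q` locally uniformly on `D` as `δ → 0⁺` (both `i`), then for EVERY
chordal `φ'` and EVERY holomorphic `q'` with `q'³ = ψ'′/ψ'` there are normalisers `c'_δ` with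
`c'_δ · F i δ → q'`: `q' = ω q` on `D` for a constant unit `ω`
(`deriv_symm_div_symm_eq_of_isChordalUniformizing`, `cubeRootBranch_exists_const`), and
`c'_δ := ω c_δ` works. (Smirnov 2010, §5, paragraph before Remark 5.1, at `σ = 1/3`.) [folklore] -/
theorem projectiveLimit_forall_of_exists {D : DobrushinDomain} {F : Fin 2 → ℝ → ℂ → ℂ}
    (h : ∃ φ : ConformalEquiv UpperHalfPlane.upperHalfPlaneSet D.carrier,
      D.IsChordalUniformizing φ ∧
      ∃ q : ℂ → ℂ, DifferentiableOn ℂ q D.carrier ∧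
        (∀ w ∈ D.carrier, q w ^ 3 = deriv φ.symm w / φ.symm w) ∧
      ∃ c : ℝ → ℂ, ∀ i : Fin 2,
        TendstoLocallyUniformlyOn (fun (δ : ℝ) (w : ℂ) => c δ * F i δ w) q
          (𝓝[>] (0 : ℝ)) D.carrier)
    (φ' : ConformalEquiv UpperHalfPlane.upperHalfPlaneSet D.carrier)
    (hφ' : D.IsChordalUniformizing φ') (q' : ℂ → ℂ) (hq' : DifferentiableOn ℂ q' D.carrier)
    (hq'3 : ∀ w ∈ D.carrier, q' w ^ 3 = deriv φ'.symm w / φ'.symm w) :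
    ∃ c' : ℝ → ℂ, ∀ i : Fin 2,
      TendstoLocallyUniformlyOn (fun (δ : ℝ) (w : ℂ) => c' δ * F i δ w) q'
        (𝓝[>] (0 : ℝ)) D.carrier := by
  obtain ⟨φ, hφ, q, hq, hq3, c, hlim⟩ := h
  have hq'3φ : ∀ w ∈ D.carrier, q' w ^ 3 = deriv φ.symm w / φ.symm w := fun w hw =>
    (hq'3 w hw).trans (deriv_symm_div_symm_eq_of_isChordalUniformizing hφ hφ' hw)
  obtain ⟨ω, -, heq⟩ := cubeRootBranch_exists_const φ hq.continuousOn hq'.continuousOn hq3 hq'3φ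
  refine ⟨fun δ => ω * c δ, fun i => ?_⟩
  have h2 := (uniformContinuous_const_smul ω).comp_tendstoLocallyUniformlyOn (hlim i)
  refine (h2.congr fun δ w _ => ?_).congr_right fun w hw => ?_
  · simp only [Function.comp_apply, smul_eq_mul]
    ring
  · rw [Function.comp_apply, smul_eq_mul, heq hw]

/-- If `c_n · F_n → L ≠ 0` and `c'_n · F_n → L'` for the same `F`, then `c'_n / c_n → L'/L`.
[folklore] -/
theorem tendsto_div_of_tendsto_mul {ι : Type*} {l : Filter ι} {c c' F : ι → ℂ} {L L' : ℂ}
    (hL : L ≠ 0) (hc : Tendsto (fun n => c n * F n) l (𝓝 L))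
    (hc' : Tendsto (fun n => c' n * F n) l (𝓝 L')) :
    Tendsto (fun n => c' n / c n) l (𝓝 (L' / L)) := by
  refine (hc'.div hc hL).congr' ?_
  filter_upwards [hc.eventually_ne hL] with n hn
  exact mul_div_mul_right (c' n) (c n) (right_ne_zero_of_mul hn)

/-- **Amplitude transfer between normalisers.** If `c_δ F_δ → L ≠ 0`, `c'_δ F_δ → L'` with
`‖L'‖ = ‖L‖`, and `‖c_δ‖ δ^σ → C`, then `‖c'_δ‖ δ^σ → C` (`‖c'_δ‖ / ‖c_δ‖ → ‖L'/L‖ = 1`).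
[folklore] -/
theorem amplitude_transfer {l : Filter ℝ} {c c' F : ℝ → ℂ} {L L' : ℂ} {C σ : ℝ} (hL : L ≠ 0)
    (hLL' : ‖L'‖ = ‖L‖) (hc : Tendsto (fun δ => c δ * F δ) l (𝓝 L))
    (hc' : Tendsto (fun δ => c' δ * F δ) l (𝓝 L'))
    (hT : Tendsto (fun δ => ‖c δ‖ * δ ^ σ) l (𝓝 C)) :
    Tendsto (fun δ => ‖c' δ‖ * δ ^ σ) l (𝓝 C) := by
  have h1 : Tendsto (fun δ => ‖c' δ / c δ‖) l (𝓝 1) := by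
    have h := (tendsto_div_of_tendsto_mul hL hc hc').norm
    rwa [norm_div, hLL', div_self (norm_ne_zero_iff.mpr hL)] at h
  have hne : ∀ᶠ δ in l, c δ ≠ 0 :=
    (hc.eventually_ne hL).mono fun δ h => left_ne_zero_of_mul h
  have h2 := h1.mul hT
  rw [one_mul] at h2
  refine h2.congr' ?_
  filter_upwards [hne] with δ hδ
  have hcn : ‖c δ‖ ≠ 0 := norm_ne_zero_iff.mpr hδ
  rw [norm_div, div_mul_eq_mul_div, div_eq_iff hcn]
  ring

/-- **The amplitude does not depend on the uniformizer, the branch or the normaliser.** On a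
Dobrushin domain `D`, let `F i δ : ℂ → ℂ` (`i : Fin 2`) be any approximants. If
`c_δ · F i δ → q` locally uniformly on `D` for a chordal `φ` and a holomorphic `q` with
`q³ = ψ'/ψ`, and `c'_δ · F i δ → q'` for another chordal `φ'` and branch `q'`, then
`‖c_δ‖ δ^σ → C` implies `‖c'_δ‖ δ^σ → C`: `q' = ω q` with `‖ω‖ = 1`, `q` is zero-free
(`deriv_symm_div_symm_ne_zero`), and `amplitude_transfer` applies at a point of `D`.
(Stub worker of `stub_canonicalAmplitude`, 2026-08-17.) [folklore] -/
theorem amplitude_of_other_normalisation {D : DobrushinDomain} (F : Fin 2 → ℝ → ℂ → ℂ)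
    {φ φ' : ConformalEquiv UpperHalfPlane.upperHalfPlaneSet D.carrier}
    (hφ : D.IsChordalUniformizing φ) (hφ' : D.IsChordalUniformizing φ')
    {q q' : ℂ → ℂ} (hq : DifferentiableOn ℂ q D.carrier)
    (hq3 : ∀ w ∈ D.carrier, q w ^ 3 = deriv φ.symm w / φ.symm w)
    (hq' : DifferentiableOn ℂ q' D.carrier)
    (hq'3 : ∀ w ∈ D.carrier, q' w ^ 3 = deriv φ'.symm w / φ'.symm w)
    {c c' : ℝ → ℂ}
    (hc : ∀ i : Fin 2, TendstoLocallyUniformlyOn (fun (δ : ℝ) (w : ℂ) => c δ * F i δ w) q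
      (𝓝[>] (0 : ℝ)) D.carrier)
    (hc' : ∀ i : Fin 2, TendstoLocallyUniformlyOn (fun (δ : ℝ) (w : ℂ) => c' δ * F i δ w) q'
      (𝓝[>] (0 : ℝ)) D.carrier)
    {C σ : ℝ} (hT : Tendsto (fun δ : ℝ => ‖c δ‖ * δ ^ σ) (𝓝[>] (0 : ℝ)) (𝓝 C)) :
    Tendsto (fun δ : ℝ => ‖c' δ‖ * δ ^ σ) (𝓝[>] (0 : ℝ)) (𝓝 C) := by
  obtain ⟨w, hw⟩ := D.toJordanDomain.nonempty
  have hq'3φ : ∀ z ∈ D.carrier, q' z ^ 3 = deriv φ.symm z / φ.symm z := fun z hz =>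
    (hq'3 z hz).trans (deriv_symm_div_symm_eq_of_isChordalUniformizing hφ hφ' hz)
  obtain ⟨ω, hω, heq⟩ :=
    cubeRootBranch_exists_const φ hq.continuousOn hq'.continuousOn hq3 hq'3φ
  have hqw : q w ≠ 0 := by
    intro h0
    have h1 := hq3 w hw
    rw [h0, zero_pow three_ne_zero] at h1
    exact deriv_symm_div_symm_ne_zero φ hw h1.symm
  have h0 : Tendsto (fun δ : ℝ => c δ * F 0 δ w) (𝓝[>] (0 : ℝ)) (𝓝 (q w)) :=
    (hc 0).tendsto_at hw
  have h0' : Tendsto (fun δ : ℝ => c' δ * F 0 δ w) (𝓝[>] (0 : ℝ)) (𝓝 (q' w)) :=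
    (hc' 0).tendsto_at hw
  have hnorm : ‖q' w‖ = ‖q w‖ := by rw [heq hw, norm_mul, hω, one_mul]
  exact amplitude_transfer hqw hnorm h0 h0' hT

end Normalisation

/-! ### The stub statements as named `Prop`s

`Stubs.stub_projectiveShape` / `Stubs.stub_canonicalAmplitude` are the birth skeleton's SHAPE
and SIZE propositions (kept verbatim: the composition still runs through them);
`Stubs.stub_shapeCore` / `Stubs.stub_sizeCore` are their cores, the propositions of the two
REGISTERED stubs `stub_shapeCore`, `stub_sizeCore` below (the only `sorry`s of the file). -/

namespace Stubs

/-- Birth SHAPE `Prop` (no longer a registered stub; derived from `stub_shapeCore` by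
`projectiveShape_of_core`). -/
def stub_projectiveShape : Prop :=
  Summit.CriticalPhenomena.CardyFormulaZ2.Theses.CardyDualCurrent.DualCurrentTemplateR → ∃ (r m : ℕ) (z : Fin 2 → Fin m → Literature.Probability.LatticeModels.MedialVertex) (s : Fin 2 → Fin m → ℝ) (g : Fin 2 → Fin m → Set Literature.Probability.LatticeModels.MedialVertex → ℂ), (∀ i k, Literature.Probability.LatticeModels.medialGraph.edist s((0 : Literature.Probability.LatticeModels.Site 2), Pi.single i 1) (z i k) ≤ (r : ℕ∞)) ∧ (let G : Literature.Probability.LatticeModels.DiscreteDobrushin → Literature.Probability.LatticeModels.Site 2 → Fin 2 → ℂ := fun D x i => ∫ cfg, (∑ k, g i k {e | Literature.Probability.LatticeModels.medialGraph.edist s((0 : Literature.Probability.LatticeModels.Site 2), Pi.single i 1) e ≤ (r : ℕ∞) ∧ Sym2.map (· + x) e ∈ cfg} * Literature.Probability.LatticeModels.passageSum (Literature.Probability.LatticeModels.fkInterface D cfg) D.δ (s i k) (Sym2.map (· + x) (z i k))) ∂(Literature.Probability.Percolation.bondPercolation (Literature.Probability.LatticeModels.zdGraph 2) Literature.Probability.Percolation.half);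 let W : Literature.Probability.LatticeModels.DiscreteDobrushin → Literature.Probability.LatticeModels.Site 2 → Fin 2 → ℕ → Prop := fun D x i ρ => ∀ e, Literature.Probability.LatticeModels.medialGraph.edist s((0 : Literature.Probability.LatticeModels.Site 2), Pi.single i 1) e ≤ (ρ : ℕ∞) → Sym2.map (· + x) e ∈ D.innerMedialVertices; (∀ D : Literature.Probability.LatticeModels.DiscreteDobrushin, D.IsZdAdmissible → ((Literature.Probability.LatticeModels.discreteDomainGraph D.Ω D.δ).induce D.zdArcA).Preconnected → (∀ x, W D x 0 r → W D x 1 r → W D (x - Pi.single 0 1) 0 r → W D (x - Pi.single 1 1) 1 r → G D x 1 - G D (x - Pi.single 1 1) 1 = Complex.I * (G D x 0 - G D (x - Pi.single 0 1) 0)) ∧ (∀ f, W D f 0 r → W D (f + Pi.single 1 1) 0 r → W D f 1 r → W D (f + Pi.single 0 1) 1 r → G D (f + Pi.single 1 1) 0 - G D f 0 = Complex.I * (G D (f + Pi.single 0 1) 1 - G D f 1))) ∧ ¬ (∀ D : Literature.Probability.LatticeModels.DiscreteDobrushin, D.IsZdAdmissible → ((Literature.Probability.LatticeModels.discreteDomainGraph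 D.Ω D.δ).induce D.zdArcA).Preconnected → ∀ x x' i, W D x i (r + 2) → W D x' i (r + 2) → G D x i = G D x' i)) ∧ (let G : Literature.Probability.LatticeModels.DiscreteDobrushin → Literature.Probability.LatticeModels.Site 2 → Fin 2 → ℂ := fun D x i => ∫ cfg, (∑ k, g i k {e | Literature.Probability.LatticeModels.medialGraph.edist s((0 : Literature.Probability.LatticeModels.Site 2), Pi.single i 1) e ≤ (r : ℕ∞) ∧ Sym2.map (· + x) e ∈ cfg} * Literature.Probability.LatticeModels.passageSum (Literature.Probability.LatticeModels.fkInterface D cfg) D.δ (s i k) (Sym2.map (· + x) (z i k))) ∂(Literature.Probability.Percolation.bondPercolation (Literature.Probability.LatticeModels.zdGraph 2) Literature.Probability.Percolation.half); ∀ (D : Literature.Probability.RandomPlanarGeometry.DobrushinDomain) (E : ℝ → Literature.Probability.LatticeModels.DiscreteDobrushin), Literature.Probability.LatticeModels.ZdDiscretisationFamily D E → ∀ (φ : Literature.Probability.RandomPlanarGeometry.ConformalEquiv UpperHalfPlane.upperHalfPlaneSet D.carrier), D.IsChordalUniformizing φ → ∀ q : ℂ → ℂ, DifferentiableOn ℂ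 q D.carrier → (∀ w ∈ D.carrier, q w ^ 3 = deriv φ.symm w / φ.symm w) → ∃ c : ℝ → ℂ, ∀ i : Fin 2, TendstoLocallyUniformlyOn (fun (δ : ℝ) (w : ℂ) => c δ * G (E δ) (fun j => ⌊(if j = 0 then w.re else w.im) / δ⌋) i) q (𝓝[>] (0 : ℝ)) D.carrier)

/-- Birth SIZE `Prop` (no longer a registered stub; derived from `stub_sizeCore` by
`canonicalAmplitude_of_core`). -/
def stub_canonicalAmplitude : Prop :=
  ∀ (r m : ℕ) (z : Fin 2 → Fin m → Literature.Probability.LatticeModels.MedialVertex) (s : Fin 2 → Fin m → ℝ) (g : Fin 2 → Fin m → Set Literature.Probability.LatticeModels.MedialVertex → ℂ), (∀ i k, Literature.Probability.LatticeModels.medialGraph.edist s((0 : Literature.Probability.LatticeModels.Site 2), Pi.single i 1) (z i k) ≤ (r : ℕ∞)) → (let G : Literature.Probability.LatticeModels.DiscreteDobrushin → Literature.Probability.LatticeModels.Site 2 → Fin 2 → ℂ := fun D x i => ∫ cfg, (∑ k, g i k {e | Literature.Probability.LatticeModels.medialGraph.edist s((0 : Literature.Probability.LatticeModels.Site 2),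 Pi.single i 1) e ≤ (r : ℕ∞) ∧ Sym2.map (· + x) e ∈ cfg} * Literature.Probability.LatticeModels.passageSum (Literature.Probability.LatticeModels.fkInterface D cfg) D.δ (s i k) (Sym2.map (· + x) (z i k))) ∂(Literature.Probability.Percolation.bondPercolation (Literature.Probability.LatticeModels.zdGraph 2) Literature.Probability.Percolation.half); let W : Literature.Probability.LatticeModels.DiscreteDobrushin → Literature.Probability.LatticeModels.Site 2 → Fin 2 → ℕ → Prop := fun D x i ρ => ∀ e, Literature.Probability.LatticeModels.medialGraph.edist s((0 : Literature.Probability.LatticeModels.Site 2), Pi.single i 1) e ≤ (ρ : ℕ∞) → Sym2.map (· + x) e ∈ D.innerMedialVertices; (∀ D : Literature.Probability.LatticeModels.DiscreteDobrushin, D.IsZdAdmissible → ((Literature.Probability.LatticeModels.discreteDomainGraph D.Ω D.δ).induce D.zdArcA).Preconnected → (∀ x, W D x 0 r → W D x 1 r → W D (x - Pi.single 0 1) 0 r → W D (x - Pi.single 1 1) 1 r → G D x 1 - G D (x - Pi.single 1 1) 1 = Complex.I * (G D x 0 - G D (x - Pi.single 0 1) 0)) ∧ (∀ f, W D f 0 r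 → W D (f + Pi.single 1 1) 0 r → W D f 1 r → W D (f + Pi.single 0 1) 1 r → G D (f + Pi.single 1 1) 0 - G D f 0 = Complex.I * (G D (f + Pi.single 0 1) 1 - G D f 1))) ∧ ¬ (∀ D : Literature.Probability.LatticeModels.DiscreteDobrushin, D.IsZdAdmissible → ((Literature.Probability.LatticeModels.discreteDomainGraph D.Ω D.δ).induce D.zdArcA).Preconnected → ∀ x x' i, W D x i (r + 2) → W D x' i (r + 2) → G D x i = G D x' i)) → ∃ C : ℝ, 0 < C ∧ (let G : Literature.Probability.LatticeModels.DiscreteDobrushin → Literature.Probability.LatticeModels.Site 2 → Fin 2 → ℂ := fun D x i => ∫ cfg, (∑ k, g i k {e | Literature.Probability.LatticeModels.medialGraph.edist s((0 : Literature.Probability.LatticeModels.Site 2), Pi.single i 1) e ≤ (r : ℕ∞) ∧ Sym2.map (· + x) e ∈ cfg} * Literature.Probability.LatticeModels.passageSum (Literature.Probability.LatticeModels.fkInterface D cfg) D.δ (s i k) (Sym2.map (· + x) (z i k))) ∂(Literature.Probability.Percolation.bondPercolation (Literature.Probability.LatticeModels.zdGraph 2) Literature.Probability.Percolation.half); ∀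 (D : Literature.Probability.RandomPlanarGeometry.DobrushinDomain) (E : ℝ → Literature.Probability.LatticeModels.DiscreteDobrushin), Literature.Probability.LatticeModels.ZdDiscretisationFamily D E → ∀ (φ : Literature.Probability.RandomPlanarGeometry.ConformalEquiv UpperHalfPlane.upperHalfPlaneSet D.carrier), D.IsChordalUniformizing φ → ∀ q : ℂ → ℂ, DifferentiableOn ℂ q D.carrier → (∀ w ∈ D.carrier, q w ^ 3 = deriv φ.symm w / φ.symm w) → ∀ c : ℝ → ℂ, (∀ i : Fin 2, TendstoLocallyUniformlyOn (fun (δ : ℝ) (w : ℂ) => c δ * G (E δ) (fun j => ⌊(if j = 0 then w.re else w.im) / δ⌋) i) q (𝓝[>] (0 : ℝ)) D.carrier) → Filter.Tendsto (fun δ : ℝ => ‖c δ‖ * δ ^ (1 / 3 : ℝ)) (𝓝[>] (0 : ℝ)) (𝓝 C))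

/-- Morera `Prop` (registered stub `stub_limitHolomorphic`, PROVED by the lead, cycle 1):
subsequential limits of a renormalised exactly-CR template observable along a discretisation
family are holomorphic in the sum `g 0 + g 1` of the two edge types. -/
def stub_limitHolomorphic : Prop :=
  ∀ (T : Literature.Probability.LatticeModels.LocalParafermionicTemplate) (D : Literature.Probability.RandomPlanarGeometry.DobrushinDomain) (E : ℝ → Literature.Probability.LatticeModels.DiscreteDobrushin), Literature.Probability.LatticeModels.ZdDiscretisationFamily D E → ∀ (s : ℕ → ℝ), Filter.Tendsto s Filter.atTop (𝓝[>] (0 : ℝ)) → (∀ᶠ k in Filter.atTop, T.IsExactCRIn (E (s k))) → ∀ (c : ℕ → ℂ) (g : Fin 2 → ℂ → ℂ), (∀ i, ContinuousOn (g i) D.carrier) → (∀ (i : Fin 2) (K : Set ℂ), K ⊆ D.carrier → IsCompact K → TendstoUniformlyOn (fun (k : ℕ) (w : ℂ) => c k * T.obs (E (s k)) (fun j => ⌊(if j = 0 then w.re else w.im) / s k⌋) i) (g i) Filter.atTop K) → DifferentiableOn ℂ (fun w => g 0 w + g 1 w) D.carrier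

/-- Anti-Morera `Prop` (registered stub `stub_limitAntiHolomorphic`, PROVED by the lead, cycle 1):
the difference of the two edge-type limits is ANTI-holomorphic (`conj (g 0 - g 1)` holomorphic),
by Morera for the conjugate-staggered template. -/
def stub_limitAntiHolomorphic : Prop :=
  ∀ (T : Literature.Probability.LatticeModels.LocalParafermionicTemplate) (D : Literature.Probability.RandomPlanarGeometry.DobrushinDomain) (E : ℝ → Literature.Probability.LatticeModels.DiscreteDobrushin), Literature.Probability.LatticeModels.ZdDiscretisationFamily D E → ∀ (s : ℕ → ℝ), Filter.Tendsto s Filter.atTop (𝓝[>] (0 : ℝ)) → (∀ᶠ k in Filter.atTop, T.IsExactCRIn (E (s k))) → ∀ (c : ℕ → ℂ) (g : Fin 2 → ℂ → ℂ), (∀ i, ContinuousOn (g i) D.carrier) → (∀ (i : Fin 2) (K : Set ℂ), K ⊆ D.carrier → IsCompact K → TendstoUniformlyOn (fun (k : ℕ) (w : ℂ) => c k * T.obs (E (s k)) (fun j => ⌊(if j = 0 then w.re else w.im) / s k⌋) i) (g i) Filter.atTop K) → DifferentiableOn ℂ (fun w => (starRingEnd ℂ) (g 0 w - g 1 w)) 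D.carrier

/-- Precompactness `Prop` (registered stub `stub_precompactOfBounded`, PROVED by the lead,
cycle 1): along a discretisation family, an exactly-CR template observable whose renormalisation is
locally bounded has locally uniformly convergent subsequences (both edge types, continuous limits). -/
def stub_precompactOfBounded : Prop :=
  ∀ (T : Literature.Probability.LatticeModels.LocalParafermionicTemplate) (D : Literature.Probability.RandomPlanarGeometry.DobrushinDomain) (E : ℝ → Literature.Probability.LatticeModels.DiscreteDobrushin), Literature.Probability.LatticeModels.ZdDiscretisationFamily D E → ∀ (s : ℕ → ℝ), Filter.Tendsto s Filter.atTop (𝓝[>] (0 : ℝ)) → (∀ᶠ k in Filter.atTop, T.IsExactCRIn (E (s k))) → ∀ (c : ℕ → ℂ), (∀ (K : Set ℂ), K ⊆ D.carrier → IsCompact K → ∃ M : ℝ, ∀ᶠ k in Filter.atTop, ∀ (i : Fin 2), ∀ w ∈ K, ‖c k * T.obs (E (s k)) (fun j => ⌊(if j = 0 then w.re else w.im) / s k⌋) i‖ ≤ M) → ∃ φ : ℕ → ℕ, StrictMono φ ∧ ∃ g : Fin 2 → ℂ → ℂ, (∀ i, ContinuousOn (g i) D.carrier) ∧ ∀ (i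 : Fin 2) (K : Set ℂ), K ⊆ D.carrier → IsCompact K → TendstoUniformlyOn (fun (k : ℕ) (w : ℂ) => c (φ k) * T.obs (E (s (φ k))) (fun j => ⌊(if j = 0 then w.re else w.im) / s (φ k)⌋) i) (g i) Filter.atTop K

/-- Core SHAPE `Prop` given the analysis (registered stub `stub_shapeBoundsAndIdentification`):
assuming the Morera, anti-Morera and precompactness-from-bounds statements (all proved, for
free), produce for SOME exactly-CR non-degenerate template one chordal map, one branch and some
normalisers per domain and family with projective convergence — i.e. supply the a priori local
bounds for suitable normalisers and identify the subsequential limits. -/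
def stub_shapeBoundsAndIdentification : Prop :=
  (∀ (T : Literature.Probability.LatticeModels.LocalParafermionicTemplate) (D : Literature.Probability.RandomPlanarGeometry.DobrushinDomain) (E : ℝ → Literature.Probability.LatticeModels.DiscreteDobrushin), Literature.Probability.LatticeModels.ZdDiscretisationFamily D E → ∀ (s : ℕ → ℝ), Filter.Tendsto s Filter.atTop (𝓝[>] (0 : ℝ)) → (∀ᶠ k in Filter.atTop, T.IsExactCRIn (E (s k))) → ∀ (c : ℕ → ℂ) (g : Fin 2 → ℂ → ℂ), (∀ i, ContinuousOn (g i) D.carrier) → (∀ (i : Fin 2) (K : Set ℂ), K ⊆ D.carrier → IsCompact K → TendstoUniformlyOn (fun (k : ℕ) (w : ℂ) => c k * T.obs (E (s k)) (fun j => ⌊(if j = 0 then w.re else w.im) / s k⌋) i) (g i) Filter.atTop K) → DifferentiableOn ℂ (fun w => g 0 w + g 1 w) D.carrier) → (∀ (T : Literature.Probability.LatticeModels.LocalParafermionicTemplate) (D : Literature.Probability.RandomPlanarGeometry.DobrushinDomain) (E : ℝ → Literature.Probability.LatticeModels.DiscreteDobrushin), Literature.Probability.LatticeModels.ZdDiscretisationFamily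 D E → ∀ (s : ℕ → ℝ), Filter.Tendsto s Filter.atTop (𝓝[>] (0 : ℝ)) → (∀ᶠ k in Filter.atTop, T.IsExactCRIn (E (s k))) → ∀ (c : ℕ → ℂ) (g : Fin 2 → ℂ → ℂ), (∀ i, ContinuousOn (g i) D.carrier) → (∀ (i : Fin 2) (K : Set ℂ), K ⊆ D.carrier → IsCompact K → TendstoUniformlyOn (fun (k : ℕ) (w : ℂ) => c k * T.obs (E (s k)) (fun j => ⌊(if j = 0 then w.re else w.im) / s k⌋) i) (g i) Filter.atTop K) → DifferentiableOn ℂ (fun w => (starRingEnd ℂ) (g 0 w - g 1 w)) D.carrier) → (∀ (T : Literature.Probability.LatticeModels.LocalParafermionicTemplate) (D : Literature.Probability.RandomPlanarGeometry.DobrushinDomain) (E : ℝ → Literature.Probability.LatticeModels.DiscreteDobrushin), Literature.Probability.LatticeModels.ZdDiscretisationFamily D E → ∀ (s : ℕ → ℝ), Filter.Tendsto s Filter.atTop (𝓝[>] (0 : ℝ)) → (∀ᶠ k in Filter.atTop, T.IsExactCRIn (E (s k))) → ∀ (c : ℕ → ℂ), (∀ (K : Set ℂ), K ⊆ D.carrier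 → IsCompact K → ∃ M : ℝ, ∀ᶠ k in Filter.atTop, ∀ (i : Fin 2), ∀ w ∈ K, ‖c k * T.obs (E (s k)) (fun j => ⌊(if j = 0 then w.re else w.im) / s k⌋) i‖ ≤ M) → ∃ φ : ℕ → ℕ, StrictMono φ ∧ ∃ g : Fin 2 → ℂ → ℂ, (∀ i, ContinuousOn (g i) D.carrier) ∧ ∀ (i : Fin 2) (K : Set ℂ), K ⊆ D.carrier → IsCompact K → TendstoUniformlyOn (fun (k : ℕ) (w : ℂ) => c (φ k) * T.obs (E (s (φ k))) (fun j => ⌊(if j = 0 then w.re else w.im) / s (φ k)⌋) i) (g i) Filter.atTop K) → (Summit.CriticalPhenomena.CardyFormulaZ2.Theses.CardyDualCurrent.DualCurrentTemplateR → ∃ T : Literature.Probability.LatticeModels.LocalParafermionicTemplate, T.IsExactCR ∧ T.Nondegenerate ∧ ∀ (D : Literature.Probability.RandomPlanarGeometry.DobrushinDomain) (E : ℝ → Literature.Probability.LatticeModels.DiscreteDobrushin), Literature.Probability.LatticeModels.ZdDiscretisationFamily D E → ∃ φ : Literature.Probability.RandomPlanarGeometry.ConformalEquiv UpperHalfPlane.upperHalfPlaneSet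 D.carrier, D.IsChordalUniformizing φ ∧ ∃ q : ℂ → ℂ, DifferentiableOn ℂ q D.carrier ∧ (∀ w ∈ D.carrier, q w ^ 3 = deriv φ.symm w / φ.symm w) ∧ ∃ c : ℝ → ℂ, ∀ i : Fin 2, TendstoLocallyUniformlyOn (fun (δ : ℝ) (w : ℂ) => c δ * T.obs (E δ) (fun j => ⌊(if j = 0 then w.re else w.im) / δ⌋) i) q (𝓝[>] (0 : ℝ)) D.carrier)

/-- Core SHAPE `Prop` given Morera only (reshape-2 stub, no longer registered: it is
`stub_shapeBoundsAndIdentification` with the precompactness statement supplied). -/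
def stub_shapeFromMorera : Prop :=
  (∀ (T : Literature.Probability.LatticeModels.LocalParafermionicTemplate) (D : Literature.Probability.RandomPlanarGeometry.DobrushinDomain) (E : ℝ → Literature.Probability.LatticeModels.DiscreteDobrushin), Literature.Probability.LatticeModels.ZdDiscretisationFamily D E → ∀ (s : ℕ → ℝ), Filter.Tendsto s Filter.atTop (𝓝[>] (0 : ℝ)) → (∀ᶠ k in Filter.atTop, T.IsExactCRIn (E (s k))) → ∀ (c : ℕ → ℂ) (g : Fin 2 → ℂ → ℂ), (∀ i, ContinuousOn (g i) D.carrier) → (∀ (i : Fin 2) (K : Set ℂ), K ⊆ D.carrier → IsCompact K → TendstoUniformlyOn (fun (k : ℕ) (w : ℂ) => c k * T.obs (E (s k)) (fun j => ⌊(if j = 0 then w.re else w.im) / s k⌋) i) (g i) Filter.atTop K) → DifferentiableOn ℂ (fun w => g 0 w + g 1 w) D.carrier) → (Summit.CriticalPhenomena.CardyFormulaZ2.Theses.CardyDualCurrent.DualCurrentTemplateR → ∃ T : Literature.Probability.LatticeModels.LocalParafermionicTemplate, T.IsExactCR ∧ T.Nondegenerate ∧ ∀ (D : Literature.Probability.RandomPlanarGeometry.DobrushinDomain)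 (E : ℝ → Literature.Probability.LatticeModels.DiscreteDobrushin), Literature.Probability.LatticeModels.ZdDiscretisationFamily D E → ∃ φ : Literature.Probability.RandomPlanarGeometry.ConformalEquiv UpperHalfPlane.upperHalfPlaneSet D.carrier, D.IsChordalUniformizing φ ∧ ∃ q : ℂ → ℂ, DifferentiableOn ℂ q D.carrier ∧ (∀ w ∈ D.carrier, q w ^ 3 = deriv φ.symm w / φ.symm w) ∧ ∃ c : ℝ → ℂ, ∀ i : Fin 2, TendstoLocallyUniformlyOn (fun (δ : ℝ) (w : ℂ) => c δ * T.obs (E δ) (fun j => ⌊(if j = 0 then w.re else w.im) / δ⌋) i) q (𝓝[>] (0 : ℝ)) D.carrier)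

/-- Core SHAPE `Prop` (birth-core form, no longer registered: it is `stub_shapeFromMorera`
applied to `stub_limitHolomorphic`). -/
def stub_shapeCore : Prop :=
  Summit.CriticalPhenomena.CardyFormulaZ2.Theses.CardyDualCurrent.DualCurrentTemplateR → ∃ T : Literature.Probability.LatticeModels.LocalParafermionicTemplate, T.IsExactCR ∧ T.Nondegenerate ∧ ∀ (D : Literature.Probability.RandomPlanarGeometry.DobrushinDomain) (E : ℝ → Literature.Probability.LatticeModels.DiscreteDobrushin), Literature.Probability.LatticeModels.ZdDiscretisationFamily D E → ∃ φ : Literature.Probability.RandomPlanarGeometry.ConformalEquiv UpperHalfPlane.upperHalfPlaneSet D.carrier, D.IsChordalUniformizing φ ∧ ∃ q : ℂ → ℂ, DifferentiableOn ℂ q D.carrier ∧ (∀ w ∈ D.carrier, q w ^ 3 = deriv φ.symm w / φ.symm w) ∧ ∃ c : ℝ → ℂ, ∀ i : Fin 2, TendstoLocallyUniformlyOn (fun (δ : ℝ) (w : ℂ) => c δ * T.obs (E δ) (fun j => ⌊(if j = 0 then w.re else w.im) / δ⌋) i) q (𝓝[>] (0 : ℝ)) D.carrier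

/-- Core SIZE `Prop` (registered stub `stub_sizeCore`): for every exactly-CR non-degenerate
template ONE `C > 0`; per domain and family, if some normalisation converges projectively then
some normalisation does so with the sharp amplitude `‖c_δ‖ δ^{1/3} → C`. -/
def stub_sizeCore : Prop :=
  ∀ T : Literature.Probability.LatticeModels.LocalParafermionicTemplate, T.IsExactCR → T.Nondegenerate → ∃ C : ℝ, 0 < C ∧ ∀ (D : Literature.Probability.RandomPlanarGeometry.DobrushinDomain) (E : ℝ → Literature.Probability.LatticeModels.DiscreteDobrushin), Literature.Probability.LatticeModels.ZdDiscretisationFamily D E → (∃ (φ : Literature.Probability.RandomPlanarGeometry.ConformalEquiv UpperHalfPlane.upperHalfPlaneSet D.carrier) (q : ℂ → ℂ) (c : ℝ → ℂ), D.IsChordalUniformizing φ ∧ DifferentiableOn ℂ q D.carrier ∧ (∀ w ∈ D.carrier, q w ^ 3 = deriv φ.symm w / φ.symm w) ∧ ∀ i : Fin 2, TendstoLocallyUniformlyOn (fun (δ : ℝ) (w : ℂ) => c δ * T.obs (E δ) (fun j => ⌊(if j = 0 then w.re else w.im) / δ⌋) i) q (𝓝[>] (0 : ℝ)) D.carrier)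 → ∃ (φ : Literature.Probability.RandomPlanarGeometry.ConformalEquiv UpperHalfPlane.upperHalfPlaneSet D.carrier) (q : ℂ → ℂ) (c : ℝ → ℂ), D.IsChordalUniformizing φ ∧ DifferentiableOn ℂ q D.carrier ∧ (∀ w ∈ D.carrier, q w ^ 3 = deriv φ.symm w / φ.symm w) ∧ (∀ i : Fin 2, TendstoLocallyUniformlyOn (fun (δ : ℝ) (w : ℂ) => c δ * T.obs (E δ) (fun j => ⌊(if j = 0 then w.re else w.im) / δ⌋) i) q (𝓝[>] (0 : ℝ)) D.carrier) ∧ Filter.Tendsto (fun δ : ℝ => ‖c δ‖ * δ ^ (1 / 3 : ℝ)) (𝓝[>] (0 : ℝ)) (𝓝 C)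

end Stubs

/-! ### The registered stubs (the ONLY sorries of the file)

The three analysis legs `stub_limitHolomorphic`, `stub_limitAntiHolomorphic`,
`stub_precompactOfBounded` are LANDED (Theorems files imported above, same namespace and names:
p150633, p151270, p151245) and are used below by name; only the two cores blocked on the
decision crux r2 remain as sorried stubs. -/

/-- stub `stub_shapeBoundsAndIdentification` (canonical SHAPE, core form, analysis granted;
Smirnov 2010 Thm 2.2 modulo normalisation at `σ = 1/3`, for ONE chordal map and ONE branch per
domain and family): GIVEN the Morera statement (`stub_limitHolomorphic`, proved: `g₀ + g₁`
holomorphic), the anti-Morera statement (`stub_limitAntiHolomorphic`, proved: `g₀ - g₁`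
anti-holomorphic) and the precompactness statement (`stub_precompactOfBounded`, proved: local
bounds ⇒ convergent subsequences), from a witness of `DualCurrentTemplateR` produce an exactly-CR,
deep-window non-degenerate finite-range template `T` whose percolation observable `T.obs`, read
at `⌊w/δ⌋`, converges after SOME complex normalisation `c_δ` (common to both edge types) to SOME
holomorphic `q` with `q³ = ψ'/ψ` for SOME chordal uniformizer `φ = ψ⁻¹`, locally uniformly on `D`,
for every Dobrushin domain `D` and every `ZdDiscretisationFamily E`. What it still contains (the
open core): (i) A PRIORI BOUNDS — normalisers `c_δ` (expected `≍ δ^{-1/3}`) making `c_δ · T.obs`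
locally bounded with non-trivial subsequential limits (sharp one-point estimates of a
phase-weighted two-arm observable; unknown even for Smirnov's observable); (ii) IDENTIFICATION —
every subsequential limit pair has vanishing staggered part and holomorphic part `λ q`
(Riemann–Hilbert boundary values of the RE-CHOSEN template and their uniqueness; exact CR alone
does not supply them, and shift-differences of CR templates are CR with derivative limits).
Vacuously true if stmt-11201 is false. -/
theorem stub_shapeBoundsAndIdentification :
    ((∀ (T : Literature.Probability.LatticeModels.LocalParafermionicTemplate) (D : Literature.Probability.RandomPlanarGeometry.DobrushinDomain) (E : ℝ → Literature.Probability.LatticeModels.DiscreteDobrushin), Literature.Probability.LatticeModels.ZdDiscretisationFamily D E → ∀ (s : ℕ → ℝ), Filter.Tendsto s Filter.atTop (𝓝[>] (0 : ℝ)) → (∀ᶠ k in Filter.atTop, T.IsExactCRIn (E (s k))) → ∀ (c : ℕ → ℂ) (g : Fin 2 → ℂ → ℂ), (∀ i, ContinuousOn (g i) D.carrier) → (∀ (i : Fin 2) (K : Set ℂ), K ⊆ D.carrier → IsCompact K → TendstoUniformlyOn (fun (k : ℕ) (w : ℂ) => c k * T.obs (E (s k)) (fun j => ⌊(if j = 0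 then w.re else w.im) / s k⌋) i) (g i) Filter.atTop K) → DifferentiableOn ℂ (fun w => g 0 w + g 1 w) D.carrier) → (∀ (T : Literature.Probability.LatticeModels.LocalParafermionicTemplate) (D : Literature.Probability.RandomPlanarGeometry.DobrushinDomain) (E : ℝ → Literature.Probability.LatticeModels.DiscreteDobrushin), Literature.Probability.LatticeModels.ZdDiscretisationFamily D E → ∀ (s : ℕ → ℝ), Filter.Tendsto s Filter.atTop (𝓝[>] (0 : ℝ)) → (∀ᶠ k in Filter.atTop, T.IsExactCRIn (E (s k))) → ∀ (c : ℕ → ℂ) (g : Fin 2 → ℂ → ℂ), (∀ i, ContinuousOn (g i) D.carrier) → (∀ (i : Fin 2) (K : Set ℂ), K ⊆ D.carrier → IsCompact K → TendstoUniformlyOn (fun (k : ℕ) (w : ℂ) => c k * T.obs (E (s k)) (fun j => ⌊(if j = 0 then w.re else w.im) / s k⌋) i) (g i) Filter.atTop K) → DifferentiableOn ℂ (fun w => (starRingEnd ℂ) (g 0 w - g 1 w)) D.carrier) → (∀ (T : Literature.Probability.LatticeModels.LocalParafermionicTemplate) (D : Literature.Probability.RandomPlanarGeometry.DobrushinDomain)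 (E : ℝ → Literature.Probability.LatticeModels.DiscreteDobrushin), Literature.Probability.LatticeModels.ZdDiscretisationFamily D E → ∀ (s : ℕ → ℝ), Filter.Tendsto s Filter.atTop (𝓝[>] (0 : ℝ)) → (∀ᶠ k in Filter.atTop, T.IsExactCRIn (E (s k))) → ∀ (c : ℕ → ℂ), (∀ (K : Set ℂ), K ⊆ D.carrier → IsCompact K → ∃ M : ℝ, ∀ᶠ k in Filter.atTop, ∀ (i : Fin 2), ∀ w ∈ K, ‖c k * T.obs (E (s k)) (fun j => ⌊(if j = 0 then w.re else w.im) / s k⌋) i‖ ≤ M) → ∃ φ : ℕ → ℕ, StrictMono φ ∧ ∃ g : Fin 2 → ℂ → ℂ, (∀ i, ContinuousOn (g i) D.carrier) ∧ ∀ (i : Fin 2) (K : Set ℂ), K ⊆ D.carrier → IsCompact K → TendstoUniformlyOn (fun (k : ℕ) (w : ℂ) => c (φ k) * T.obs (E (s (φ k))) (fun j => ⌊(if j = 0 then w.re else w.im) / s (φ k)⌋) i) (g i) Filter.atTop K) → (Summit.CriticalPhenomena.CardyFormulaZ2.Theses.CardyDualCurrent.DualCurrentTemplateR → ∃ T : Literature.Probability.LatticeModels.LocalParafermionicTemplate,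 T.IsExactCR ∧ T.Nondegenerate ∧ ∀ (D : Literature.Probability.RandomPlanarGeometry.DobrushinDomain) (E : ℝ → Literature.Probability.LatticeModels.DiscreteDobrushin), Literature.Probability.LatticeModels.ZdDiscretisationFamily D E → ∃ φ : Literature.Probability.RandomPlanarGeometry.ConformalEquiv UpperHalfPlane.upperHalfPlaneSet D.carrier, D.IsChordalUniformizing φ ∧ ∃ q : ℂ → ℂ, DifferentiableOn ℂ q D.carrier ∧ (∀ w ∈ D.carrier, q w ^ 3 = deriv φ.symm w / φ.symm w) ∧ ∃ c : ℝ → ℂ, ∀ i : Fin 2, TendstoLocallyUniformlyOn (fun (δ : ℝ) (w : ℂ) => c δ * T.obs (E δ) (fun j => ⌊(if j = 0 then w.re else w.im) / δ⌋) i) q (𝓝[>] (0 : ℝ)) D.carrier)) := by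
  sorry

/-- stub `stub_sizeCore` (canonical SIZE, core form; the normalisation half of Smirnov 2010
Conj. 2.4 / DCS 2012 Conj. 8.7 at `q = 1` for a template): for every exactly-CR, deep-window
non-degenerate template `T` there is ONE lattice constant `C > 0` such that for every Dobrushin
domain and every discretisation family, if SOME `(φ, q, c)` realises the projective convergence
`c_δ · T.obs → q` then SOME `(φ, q, c)` realises it with `‖c_δ‖ · δ^{1/3} → C` (sharp exponent
`1/3`, amplitude universal in the domain and the family).  Vacuously true if stmt-11201 is
false. -/
theorem stub_sizeCore :
    (∀ T : Literature.Probability.LatticeModels.LocalParafermionicTemplate, T.IsExactCR → T.Nondegenerate → ∃ C : ℝ, 0 < C ∧ ∀ (D : Literature.Probability.RandomPlanarGeometry.DobrushinDomain) (E : ℝ → Literature.Probability.LatticeModels.DiscreteDobrushin), Literature.Probability.LatticeModels.ZdDiscretisationFamily D E → (∃ (φ : Literature.Probability.RandomPlanarGeometry.ConformalEquiv UpperHalfPlane.upperHalfPlaneSet D.carrier) (q : ℂ → ℂ) (c : ℝ → ℂ), D.IsChordalUniformizing φ ∧ DifferentiableOn ℂ q D.carrier ∧ (∀ w ∈ D.carrier,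 q w ^ 3 = deriv φ.symm w / φ.symm w) ∧ ∀ i : Fin 2, TendstoLocallyUniformlyOn (fun (δ : ℝ) (w : ℂ) => c δ * T.obs (E δ) (fun j => ⌊(if j = 0 then w.re else w.im) / δ⌋) i) q (𝓝[>] (0 : ℝ)) D.carrier) → ∃ (φ : Literature.Probability.RandomPlanarGeometry.ConformalEquiv UpperHalfPlane.upperHalfPlaneSet D.carrier) (q : ℂ → ℂ) (c : ℝ → ℂ), D.IsChordalUniformizing φ ∧ DifferentiableOn ℂ q D.carrier ∧ (∀ w ∈ D.carrier, q w ^ 3 = deriv φ.symm w / φ.symm w) ∧ (∀ i : Fin 2, TendstoLocallyUniformlyOn (fun (δ : ℝ) (w : ℂ) => c δ * T.obs (E δ) (fun j => ⌊(if j = 0 then w.re else w.im) / δ⌋) i) q (𝓝[>] (0 : ℝ)) D.carrier) ∧ Filter.Tendsto (fun δ : ℝ => ‖c δ‖ * δ ^ (1 / 3 : ℝ)) (𝓝[>] (0 : ℝ)) (𝓝 C)) := by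
  sorry

/-! ### From the cores to the birth stubs (sorry-free) -/

/-- **SHAPE: core ⇒ birth form.** Unpack the template structure (`LocalParafermionicTemplate.obs`
is the route's `G` by `rfl`, `IsExactCR`/`Nondegenerate` are the route's clauses by `Iff.rfl`)
and upgrade `∃ φ, ∃ q` to `∀ φ, ∀ q` with `projectiveLimit_forall_of_exists`. [folklore] -/
theorem projectiveShape_of_core (h : Stubs.stub_shapeCore) : Stubs.stub_projectiveShape := by
  unfold Stubs.stub_shapeCore at h
  unfold Stubs.stub_projectiveShape
  intro hA
  obtain ⟨T, hCR, hND, hM⟩ := h hA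
  refine ⟨T.r, T.m, T.z, T.s, T.g, T.dist_le, ⟨hCR, hND⟩, ?_⟩
  intro G D E hE φ' hφ' q' hq' hq'3
  obtain ⟨φ, hφ, q, hq, hq3, c, hc⟩ := hM D E hE
  exact projectiveLimit_forall_of_exists (F := fun i δ w =>
    T.obs (E δ) (fun j => ⌊(if j = 0 then w.re else w.im) / δ⌋) i)
    ⟨φ, hφ, q, hq, hq3, c, hc⟩ φ' hφ' q' hq' hq'3

/-- **SIZE: core ⇒ birth form.** Given any normaliser family `c` realising the convergence for
`(φ, q)`, the core supplies one `(φ₀, q₀, c₀)` with the sharp amplitude, and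
`amplitude_of_other_normalisation` transfers the amplitude to `c`. [folklore] -/
theorem canonicalAmplitude_of_core (h : Stubs.stub_sizeCore) : Stubs.stub_canonicalAmplitude := by
  unfold Stubs.stub_sizeCore at h
  unfold Stubs.stub_canonicalAmplitude
  intro r m z s g hz hCRND
  obtain ⟨hCR, hND⟩ := hCRND
  obtain ⟨C, hC, hS⟩ := h ⟨r, m, z, s, g, hz⟩ hCR hND
  refine ⟨C, hC, ?_⟩
  intro G D E hE φ hφ q hq hq3 c hc
  obtain ⟨φ₀, q₀, c₀, hφ₀, hq₀, hq₀3, hc₀, hT₀⟩ := hS D E hE ⟨φ, q, c, hφ, hq, hq3, hc⟩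
  exact amplitude_of_other_normalisation
    (fun i δ w => G (E δ) (fun j => ⌊(if j = 0 then w.re else w.im) / δ⌋) i)
    hφ₀ hφ hq₀ hq₀3 hq hq3 hc₀ hc hT₀

/-! ### Vacuity hinge on the decision crux r2 (sorry-free) -/

/-- If the open crux `DualCurrentTemplateR` (stmt-11201) is FALSE, the SHAPE core holds
vacuously. [folklore] -/
theorem shapeCore_of_not_dualCurrentTemplateR (h : ¬ DualCurrentTemplateR) :
    Stubs.stub_shapeCore :=
  fun hA => (h hA).elim

/-- If the open crux `DualCurrentTemplateR` (stmt-11201) is FALSE, the registered SHAPE stub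
holds vacuously. [folklore] -/
theorem shapeBoundsAndIdentification_of_not_dualCurrentTemplateR (h : ¬ DualCurrentTemplateR) :
    Stubs.stub_shapeBoundsAndIdentification :=
  fun _ _ _ hA => (h hA).elim

/-- If the open crux `DualCurrentTemplateR` (stmt-11201) is FALSE, the SIZE core holds
vacuously: its antecedent `T.IsExactCR ∧ T.Nondegenerate` would witness it
(`exists_isExactCR_and_nondegenerate_iff`). [folklore] -/
theorem sizeCore_of_not_dualCurrentTemplateR (h : ¬ DualCurrentTemplateR) :
    Stubs.stub_sizeCore := by
  intro T hCR hND
  exact (h (LocalParafermionicTemplate.exists_isExactCR_and_nondegenerate_iff.1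
    ⟨T, hCR, hND⟩)).elim

/-! ### The composition -/

/-- **The composition** — hypotheses = the two remaining registered stub `Prop`s BY NAME,
conclusion = the crux BY NAME: `Stubs.stub_shapeBoundsAndIdentification → Stubs.stub_sizeCore →
CardyDualCurrent.CanonicalLimitFromExactCR`.  The three analysis legs are discharged inside by
the LANDED theorems `stub_limitHolomorphic` (p150633), `stub_limitAntiHolomorphic` (p151270),
`stub_precompactOfBounded` (p151245) of the imported Theorems files; analysis ⇒ SHAPE core;
cores ⇒ birth SHAPE/SIZE (`projectiveShape_of_core`, `canonicalAmplitude_of_core`); then take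
the template of SHAPE, the constant `C` of SIZE for it; for given `(D, E, φ, q)` SHAPE gives
normalisers `c_δ`, SIZE their sharp size, and `phase_normalisation` turns `(c_δ, C)` into the unit
phases `θ_δ` of the crux. -/
theorem CanonicalLimitFromExactCR_of (h₁ : Stubs.stub_shapeBoundsAndIdentification)
    (h₂ : Stubs.stub_sizeCore) : CanonicalLimitFromExactCR := by
  have h₁' := projectiveShape_of_core
    (h₁ stub_limitHolomorphic stub_limitAntiHolomorphic stub_precompactOfBounded)
  have h₂' := canonicalAmplitude_of_core h₂
  unfold Stubs.stub_projectiveShape at h₁'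
  unfold Stubs.stub_canonicalAmplitude at h₂'
  intro hA
  obtain ⟨r, m, z, s, g, hloc, hCR, hM⟩ := h₁' hA
  obtain ⟨C, hC, hS⟩ := h₂' r m z s g hloc hCR
  refine ⟨r, m, z, s, g, C, hC, hloc, ?_⟩
  intro G D E hE φ hφ q hq hq3
  obtain ⟨c, hc⟩ := hM D E hE φ hφ q hq hq3
  have hT := hS D E hE φ hφ q hq hq3 c hc
  obtain ⟨θ, hθ, hlim⟩ := phase_normalisation hC hq.continuousOn hc hT
  exact ⟨θ, hθ, hlim⟩

/-- The skeleton IS the crux proof once the two remaining registered stubs are discharged (an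
`example`, so that `CanonicalLimitFromExactCR_of` stays the file's only theorem concluding the
crux). -/
example : CanonicalLimitFromExactCR :=
  CanonicalLimitFromExactCR_of stub_shapeBoundsAndIdentification stub_sizeCore

end Summit.CriticalPhenomena.CardyFormulaZ2.Cruxes.CanonicalLimitFromExactCR.Birth
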